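import Mathlib
import HarnessLib
import HarnessLib.Audit
import Summits.AtomisticToContinuum.Statement
import Literature.Geometry.DiscreteGeometry.TwoShellPatterns
import Literature.MathematicalPhysics.StatisticalMechanics.BarlowStacking
import Literature.MathematicalPhysics.StatisticalMechanics.LennardJonesClusters
import Summits.AtomisticToContinuum.Crystallization.Theorems.ReggeStarCoercivityDefectFreeCrystallizesHullCriterion
import Summits.AtomisticToContinuum.Crystallization.Theorems.ExcessDecayLiouvilleCrysEnergyLimit
import HarnessLib.Audit.Status.Attr

/-!
Route: PhononSlackCertificates

DORMANT since 2026-08-26T14:17:48Z (reconciler: no traction for 6.7 d (last activity item-proof-filed at 2026-08-19T21:30:08Z); parked, not closed — `ledger route dormant route-AtomisticToContinuum-PhononSlackCertificates --off` to reac) — unstaffed, not closed; items shared with open routes are served there. `ledger route dormant <id> --off` reactivates.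

# Route PhononSlackCertificates — equality-free two-shell certificates — phonon convexity over the
layered family inside, slack-only gaps outside; ground-state windows decide both conjuncts

It suffices to show X = CoerciveTwoShellGap ∧ PeriodicGivenLayered (plus soft supports), realising
idea card
equality-free-certificates-phonon-near-field (novelty audit: new-combination) as a conforming gen-2
route (gen 1, EqualityFreeCertificates,
was retired not-a-thesis: its assembly named the Literature constant instead of
`_root_.Crystallization`; its ∀ε target was also false for
relaxed hcp — repaired here). X₁ = CoerciveTwoShellGap: a COERCIVE TWO-SHELL ENERGY INEQUALITY for
Lennard-Jones in ℝ³,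
𝓔(x) ≥ N e* + g·#(1/20-bad particles), obtained from a slack-only FAR FIELD (FarFieldGapR: bad
regions pay g per particle up to boundary
slack at a δ-dependent slack radius — the regime of transfer certificates found by LP on decorated
Hales fans and certified by interval branch-and-bound) and an analytic
NEAR FIELD (NearFieldConvexity: good regions are coercive over the relaxation-tolerant LAYERED
family — phonon/elastic positivity in
co-rotated frames; no equality case is ever certified by a computer) through the levy NearFarGlueR.
X₂ = PeriodicGivenLayered: stacking
selection inside the hull (Hägg domination), the one place stacking order enters. Soft supports turn
X into BOTH conjuncts: HullBridge
(zero bad density + local layeredness ⇒ LayeredWindows), HullCriterion (PeriodicWindows ⇒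
IsCrystallizing), and the new WindowOptimality
(a periodic window of ground states is a least-energy periodic configuration, by cut and paste)
which with CrysEnergyLimit gives the
energetic conjunct with the SAME P — no separate periodic-minimum item.
Lean: `CoerciveTwoShellGap ∧ PeriodicGivenLayered ∧ HullBridge ∧ HullCriterion ∧ WindowOptimality ∧
CrysEnergyLimit`

## Assembly
Pure logic over the items plus two PROVED Literature theorems used inside the proof (no hypothesis):
LennardJonesGroundStatesExist_holds (a sequence of ground states exists) and, inside
HullBridge/HullCriterion proofs, LennardJonesMinimalDistance_holds.
closes: CoerciveTwoShellGap := NearFarGlueR FarFieldGapR NearFieldConvexity; LayeredWindows :=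
HullBridge _ NearFieldConvexity CrysEnergyLimit;
PeriodicWindows := fun x hx => PeriodicGivenLayered x hx (LayeredWindows x hx); (ii) :=
HullCriterion PeriodicWindows; pick ground states x
(proved fact), P from PeriodicWindows x, IsLeast from WindowOptimality, ⨅ = e(P) by
IsLeast.csInf_eq, Tendsto from CrysEnergyLimit;
⟨⟨P, IsLeast, Tendsto⟩, (ii)⟩ : _root_.Crystallization — checked rc 0, sorry-free, in Sketch.lean /
glue.lean.
REPAIR 2026-08-16 (route-repair unit rrefute-…-69eb937b): the original far field FarFieldGap (slack
radius FIXED at 4 under ∀δ) was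
refuted-misstated (one isolated bad particle with empty 4-boundary inside an arbitrarily dense
δ-cloud; witness formalised: three independent sorry-free Lean proofs of ¬FarFieldGap are attached
to stmt-13957 as evidence (Refutation.lean ×2, Refutation1.lean); the proposals p62965/p86053/p88031
carrying them did not land before the drop for Lean-farm availability reasons only); it was DROPPED
from the route on 2026-08-16 (unit rrepair-…-a83866ed, gate advisory glue.unused-crux: a refuted
crux that feeds no hypothesis of closes cannot stay active; the decl survives as a retired comment
line of this file). FarFieldGapR (radius R existential after δ; FarFieldGap → FarFieldGapR, so a
strict weakening, not a restatement), NearFarGlueR and the restated Assembly replace FarFieldGap,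
NearFarGlue (vacuous) and the old Assembly text.

Rationale: WHY THIS LINE. Every successful computer proof near this problem isolates the optimum analytically
and lets the machine certify only STRICT
inequalities (Hales1997 local optimality of the fcc/hcp stars; HalesDSP2012 Ch. 6–7 and
HalesEtAl2015: thousands of nonlinear inequalities
each with margin; Hales2012 arXiv:1209.6043 for kissing-twelve via tame hypermaps + LP). For an
ENERGY the isolating tool that packing
DENSITY lacks exists: the harmonic approximation — LJ equality cases are Morse–Bott clean, so the
near field is an analytic convexity
statement resting on certified eigenvalue computations (EMing2006, ELi2008, FrieseckeTheil2002,
FrieseckeJamesMuller2002; tooling shown for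
LJ fcc at N = 864 by AyalaChoksiWirth2025 arXiv:2506.22614; the rigidity-plus-defect-charge template
for atomistic energies is
LauteriLuckhaus2017), while environments 1/20-far from both two-shell patterns carry a genuine gap
(card numerics: Mackay/anti-Mackay
centres lose 4–6 % to hcp/fcc two-shells at equal cutoff) and form a slack-only certificate problem
of Flyspeck type whose
potential-independent half transfers verbatim (LJ bulk fans ARE Hales fans: second shell 1.373 =
1.414·a* > 1.26·a*; HalesFlyspeck2012).
Imported areas: certified computation / interval B&B (far field), atomistic-to-continuum elasticity
(near field), discrete geometry of
packings (HalesDSP_layerPackings_holds, proved in tree, turns exact goodness into Barlow layers),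
topological-dynamics hull reasoning
(windows). New relative to gen 1 and to the hub: goodness at ONE tolerance is only the near/far
selector and positional coercivity is
measured against the layered family (relaxation- and stacking-blind), and the energetic conjunct is
DERIVED from the windows
(WindowOptimality) instead of assumed (0627).

RANKED CRUXES. #0 CoerciveTwoShellGap (target) — COERCIVE TWO-SHELL GAP at the fixed handover
tolerance 1/20 (the card's H3 engine): for every δ > 0 there is g > 0 such that every δ-separated
N-point configuration x of ℝ³ has 𝓔_LJ(x) ≥ N·e* + g·#{i : particle i is not 1/20-good}, e* = ⨅ over
periodic Q of e(Q); 1/20-good = IsTwoShellGood (1/20) (47/50) 1 (two-way a/20-match of the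
3a/2-neighbourhood with a rotated fcc/hcp 18-point two-shell pattern at a scale a ∈ [47/50,1];
surface particles are bad). The g = 0 skeleton N·e* ≤ 𝓔(x) is free by periodisation; the content is
linear coercivity in the bad count. Deliberately NOT quantified over ε → 0 (relaxed hcp has
non-ideal c/a, so an ideal-pattern count at every ε is false; see Numbers). (why it might fail:
Fails iff 1/3-separated configurations with a positive FRACTION of 1/20-bad particles come within
o(N) of N·e*: bulk polytetrahedral/Frank–Kasper order, a non-close-packed periodic competitor tied
with hcp, or >5%-strained crystals at vanishing cost.) [BlancLewin2015, HalesDSP2012, Hales2012,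
EMing2006, LauteriLuckhaus2017, Literature.Barriers.AtomisticToContinuum.TetrahedralFrustration,
Literature.Barriers.AtomisticToContinuum.IcosahedralClusters]
#2 FarFieldGapR (crux) — REPAIRED FAR FIELD WITH δ-DEPENDENT BOUNDARY SLACK (E3 of the card; what a
pointwise slack-only transfer certificate on decorated Hales fans delivers after summing, transfers
cancelling inside U; supersedes FarFieldGap stmt-13957, refuted-misstated 2026-08-15/16 — with the
slack radius FIXED at 4 under ∀δ an isolated bad particle with empty 4-boundary inside an
arbitrarily dense δ-cloud has site energy → −∞; Lean ¬FarFieldGap ×3 in the evidence of stmt-13957;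
the refuted decl was DROPPED from the route 2026-08-16 as an unused crux): for every δ > 0 there are
g > 0, C and a slack radius R (chosen after δ; R(δ) ≈ max(4, 1.2/δ) defeats every recorded witness,
R = 4 being the design point at δ = 1/3, the only instance the route consumes) such that for every
δ-separated configuration x and every set U of 1/20-BAD particles, Σ_{i∈U} (e_i − e*) ≥ g·#U − C·#{i
∈ U : some particle outside U lies within distance R of x_i}, where e_i = ½ Σ_{j≠i} V(|x_i − x_j|)
is the site energy. FarFieldGap → FarFieldGapR (instance R = 4) and FarFieldGapR → AllBadGap (U =
all particles) are checked rc 0. No equality configuration is in scope (crystals are good); thick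
bad regions pay g per particle, thin ones are all boundary, free surfaces pay their missing bonds.
[difficulty: XL] (why it might fail: A thick all-bad bulk phase with energy density → e*
(Frank–Kasper/σ/quasicrystal approximant tied with hcp within certificate error; near-threshold 5–8
% strains, gap ~cε²), or a vacuum-gap + dense-wall geometry whose tail beyond R(δ) beats the
free-surface energy of U.) [Hales2012, HalesDSP2012, HalesFlyspeck2012, HalesEtAl2015,
Stillinger2001, BeterminSamajTravenec2022, arXiv:2004.06820, FlatleyTheil2015]
#3 NearFieldConvexity (crux) — NEAR FIELD = CONVEXITY OVER THE LAYERED FAMILY (E1–E2 of the card,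
relaxation-tolerant): for every δ > 0 and η > 0 there are c > 0 and C such that for every
δ-separated x and every set Ω of 1/20-GOOD particles, Σ_{i∈Ω} (e_i − e*) ≥ c·#{i ∈ Ω : the radius-2
ball of x_i is NOT two-way η-matched, after a translation, to a layered set} − C·#{i ∈ Ω : some
particle outside Ω lies within 4 of x_i}; layered set = rigid image of triangular layers of spacing
a ∈ [47/50,1] in hole registry along a Hägg word with free interlayer spacings in [39a/50, 17a/20]
(the format of LayeredWindows, stmt-3241). Uniform in-plane compression, c/a relaxation and
restacking cost nothing here (they are layered); shear, strain gradients, optical shuffles and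
defects pay. Intended proof: certified positive-definiteness of LJ force constants/elastic tensor of
the relaxed polytypes (interval Bloch eigenvalues; ACW 2025 did fcc N = 864) + geometric-nonlinear
expansion in co-rotated frames (E–Ming / FJM) with boundary layers charged to C. [difficulty: XL]
(why it might fail: Needs UNIFORM phonon+elastic coercivity of every relaxed Barlow polytype (not
just hcp/fcc) on the box and a convexity radius covering 5% two-shell distortions; a soft shear
branch, or good-preserving incipient slip with sub-quadratic cost, refutes it.) [EMing2006, ELi2008,
FrieseckeTheil2002, FrieseckeJamesMuller2002, AyalaChoksiWirth2025, Theil2006, OrtnerTheil2012]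
#4 NearFarGlueR (crux) — RE-POINTED GLUING / LEVY PROTOCOL (E4 of the card; supersedes NearFarGlue
stmt-13959, vacuous once its antecedent was refuted): FarFieldGapR → NearFieldConvexity →
CoerciveTwoShellGap. Partition particles into good Ω and bad B; the near field gives Σ_Ω(e_i − e*) ≥
−C·#∂₄Ω ≥ −C·K(δ)·#B, the repaired far field gives Σ_B(e_i − e*) ≥ g#B − C'#∂_R B with R = R(δ);
thin bad sets are all boundary on both sides, so the implication must improve the flat boundary
charges near mild and point-like defects to charges proportional to the actual distortion (smooth
defect measure, transfers across the interface, r⁻⁶ tail merged into the slack) so that a positive g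
survives — the inequality g > C_tail + C_interface fixes the certificate radius (expected 2–2.5
shells at δ = 1/3). [deps: FarFieldGapR, NearFieldConvexity] [difficulty: L] (why it might fail: The
levy: flat boundary constants C (near, radius 4) and C'·K(δ,R(δ)) (far, radius R ≳ 1/δ) exceed the
near-threshold gap g ~ c/400 at mild or point-like defects; unless interface charges scale with the
actual distortion, two shells do not close and the radius must grow to 3 shells.) [HalesDSP2012,
LauteriLuckhaus2017, Theil2006, FlatleyTheil2015,
Literature.Barriers.AtomisticToContinuum.TetrahedralFrustration]
#5 PeriodicGivenLayered (crux) — STACKING SELECTION INSIDE THE HULL (verbatim stmt-3242 of the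
retired route HullPeriodicPoint; the only place stacking enters): for every sequence of LJ ground
states, layered windows at every scale (free Hägg word, free spacings in the box) imply periodic
windows at every scale (one periodic configuration P two-way ε-matched on B(0,R) by translates,
frequently in N). Mechanism: Hägg domination on the box (LjRegistryDomination 3063 +
HaggDominationAllRanges 0737 of route PoissonBesselStacking) + cut-and-paste minimality of local
limits ⇒ zero fault density ⇒ fault-free slabs of every thickness. [deps: LayeredWindows]
[difficulty: L] (why it might fail: Only a SYNDETIC fault pattern in every layered energy-minimising
local limit defeats it (aperiodic optimal LJ stacking); rests on Hägg domination J₂<0, Σ(k−1)|J_k| ≤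
|J₂|/2 (numerics margin 287, uncertified) + cut-and-paste in the hull.) [RadinSchulman1983,
PartayOrtnerCsanyi2017, Stillinger2001, LoachAckland2017, BlancLewin2015,
stmt-AtomisticToContinuum-3063, stmt-AtomisticToContinuum-0737]
#9 AllBadGap (support) — Special case U = all particles (∂U = ∅) of FarFieldGapR — FarFieldGapR →
AllBadGap checked rc 0 — and the far field's cheapest falsifier (stmt-3950 restated with the landed
predicate IsTwoShellGood): δ-separated configurations in which EVERY particle is 1/20-bad have 𝓔 ≥
N·(e* + g(δ)), g > 0. [difficulty: XL] [Hales2012, Stillinger2001, BeterminSamajTravenec2022]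
#9 HullBridge (crux since the 2026-08-16 glue repair — the deciding theorem needs it and it has
content; RESTATED self-contained the same day: LayeredWindows unfolded verbatim (Iff.rfl with the
old shape) and the proved antecedent CrysEnergyLimit dropped, because a crux decl is rendered before
the support block and may only name cruxes; supersedes stmt-13961) — BRIDGE (soft
compactness/integration): CoerciveTwoShellGap → NearFieldConvexity → layered windows of every
sequence of LJ ground states (the statement of LayeredWindows). Ground states are δ-separated
(LennardJonesMinimalDistance_holds, proved) and 𝓔(x^N) = E(N) ≤ N e* + o(N) (crysEnergyLimit_proof),
so #bad = o(N); with Ω = good particles and η fixed after (R, ε), NearFieldConvexity gives o(N)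
non-η-layered good particles; packing gives a MARGIN ball B(x_p,3R) free of bad and non-layered
particles; the local-to-global step needs a junction-defect lemma (the stacking normal can switch
silently through fcc-like regions — non-parallel twins, hcp|fcc|hcp′ sandwiches are locally layered
everywhere — but every switch forces an incoherent junction within ≈1.74R of an R-ball seeing both
interfaces), after which overlapping local fits chain to ONE layered set (error ~η(R/a)² ≤ ε); one
in-layer spacing a for all (R, ε) by taking an accumulation point of the window spacings.
[difficulty: L] [BlancLewin2015, HalesDSP2012, FrieseckeJamesMuller2002, FlatleyTheil2015]
#9 LayeredWindows (support) — LAYERED WINDOWS (verbatim stmt-3241; here the OUTPUT of HullBridge and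
the input of PeriodicGivenLayered): every sequence of LJ ground states has an in-layer spacing a ∈
[47/50,1] such that for every R, ε, frequently in N, some rigid motion of x^N is two-way ε-matched
on B(0,R) with a stack of triangular layers in hole registry (free Hägg word, interlayer spacings in
[39a/50, 17a/20]). [difficulty: XL] [HalesDSP2012, BlancLewin2015]
#9 PeriodicWindows (support) — PERIODIC WINDOWS (verbatim stmt-3240, shared with route
ChessboardParticlePlanes): for every sequence of LJ ground states one periodic configuration P is
two-way ε-matched on B(0,R) by translates of x^N, frequently in N, for every R, ε. [difficulty: XL]
[BlancLewin2015]
#9 HullCriterion (support) — HULL CRITERION (verbatim stmt-3243, shared): PeriodicWindows →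
IsCrystallizing lennardJones 3 (extraction over (R, ε) = (j+1, 1/(j+1)), uniform separation δ = 1/3,
local convergence with multiplicity 1). [difficulty: provable-now] [BlancLewin2015]
#9 WindowOptimality (crux since the 2026-08-16 glue repair, same reason; finite-N cut and paste,
O(R²) interface bookkeeping) — WINDOWS OF GROUND STATES ARE OPTIMAL (new; replaces the separate
periodic-minimum item 0627): if a periodic P is two-way ε-matched on B(0,R) by translates of LJ
ground states frequently in N for every R, ε, then e(P) is a LEAST element of the energy per
particle over all periodic configurations. Proof: cut and paste — delete the ~ρR³ window particles
(removes Σ_{window} e_i + ½·interface ≥ M e(P) − C R² − o(M)) and add, far away, an M-point block of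
any periodic Q (energy ≤ M e(Q) + C_Q R²); ground-state minimality gives M e(P) ≤ M e(Q) + O(R²);
only small ε is used (matching is then a bijection by the 1/3-separation), large-ε or unmatched P
make the hypothesis vacuous. [difficulty: L] [BlancLewin2015, Theil2006]
#9 CrysEnergyLimit (support) — ENERGY LIMIT (verbatim stmt-0626, shared with PoissonBesselStacking /
ChessboardParticlePlanes; PROVED, crysEnergyLimit_proof): E(N)/N → ⨅_Q e(Q) (periodisation lower
bound + block upper bound, given boundedness below of periodic energies). [difficulty: M]
[BlancLewin2015]
#1 Assembly (assembly, restated 2026-08-16) — FarFieldGapR → NearFieldConvexity → NearFarGlueR →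
HullBridge → PeriodicGivenLayered → HullCriterion → WindowOptimality → CrysEnergyLimit →
Crystallization (re-pointed from FarFieldGap/NearFarGlue, whose first antecedent was refuted; proof
= body of closes).
DROPPED 2026-08-16 · FarFieldGap (stmt-13957, REFUTED-misstated — three independent sorry-free Lean
proofs of ¬FarFieldGap are attached to stmt-13957 as evidence (Refutation.lean ×2,
Refutation1.lean); the proposals p62965/p86053/p88031 carrying them did not land before the drop for
Lean-farm availability reasons only; removed from the route because it fed no hypothesis of `closes`
(gate advisory glue.unused-crux) and kept the route over the 7-crux cap; superseded by FarFieldGapR)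
— the original far field with slack radius fixed at 4 under ∀δ: one isolated 1/20-bad particle with
empty 4-boundary inside a dense δ-cloud (K collinear points at 5 + j/K, δ = 1/K) has site energy ≤
−cK/2 → −∞, so no g > 0 exists; lesson: site energies see the far field of arbitrarily dense
δ-separated matter, every locality radius must scale with δ.

TWO-LAYER PLAN. Foreseen glued splits (k ≤ 3, depth 1; nothing filed now): FarFieldGapR ⇐
PointwiseTransferCertificate (∃ bounded finite-range
antisymmetric τ with e_i + Σ_j τ_ij ≥ e* + g at every bad i, kit-certified per decorated tame fan) →
TailCharge (averaged r⁻⁶ tail beyond the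
certificate radius ≤ Barlow value + C·bad fraction; Kepler density bound at given minimal distance,
cf. arXiv:2004.06820; this child also fixes the slack radius R(δ) ≳ 1/δ) → FarFieldGapR.
NearFieldConvexity ⇐ PolytypePhononPositivity (interval Bloch eigenvalues + elastic tensors of
relaxed Barlow polytypes on the box, uniform in
the Hägg word by locality + tail perturbation) → CoRotatedConvexity (E–Ming/FJM lemma with boundary
layers) → NearFieldConvexity.
PeriodicGivenLayered ⇐ LjRegistryDomination (3063) → HullFaultDensityZero → PeriodicGivenLayered. A
2-D LJ(12,6) dress rehearsal of the
far/near pipeline is a support target to be filed when a prover asks (itself open: BlancLewin2015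
§2.3).

KILL CRITERIA. (i) An all-bad δ-separated family with 𝓔/N → e* (non-close-packed periodic structure,
Frank–Kasper phase or quasicrystal tied with
hcp within certificate error) refutes AllBadGap and FarFieldGapR: close `refuted:FarFieldGapR`. (ii)
A certified non-positive phonon branch /
elastic constant of a relaxed LJ polytype on the box, or a good-preserving rearrangement with
sub-quadratic cost, refutes
NearFieldConvexity: close (the doctrine has no near field left). (iii) If NearFarGlueR provably
needs g > C_tail + C_interface with the
two-shell g below every such C, the certificate radius must grow to 3 shells (~80 neighbours):
infeasible in practice — harness-declared
exhaustion with census, pivot to the frustration-range LP level R = 3 only with new tooling. (iv) A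
syndetic-fault (aperiodic) optimal LJ
stacking refutes PeriodicGivenLayered and conjunct (i) for every hull-type route: pivot impossible,
close. (v) PeriodicWindows + 0626
proved elsewhere (ChessboardParticlePlanes, PoissonBesselStacking) moot everything downstream of
CoerciveTwoShellGap but not the card's engine.

NOT DECOMPOSED YET. The transfer rule's locality format, the tame-fan case split and the explicit
slack radius R(δ) away from δ = 1/3 (children of FarFieldGapR); the explicit constants c(η), C and
the
convexity radius (children of NearFieldConvexity); the smooth defect measure of the levy
(NearFarGlueR's design point, deliberately not
frozen); the local-to-global integration lemma and the diagonal choice η_N → 0 (inside HullBridge);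
boundedness below of periodic LJ
energies (0714, needed by every prover touching e* = ⨅; shared — now PROVED,
crysPeriodicBddBelow_proof) and the block upper bound (inside 0626); the explicit LJ
min-distance beyond the proved δ = 1/3 (B&B practicality, not truth).

CHEAPEST FALSIFIER. Lookup + one cheap computation: (a) is any periodic non-Barlow structure or
known LJ quasicrystal approximant within
1e-3·|e*| of e_hcp (BeterminSamajTravenec2022 tables, Stillinger2001: fcc − hcp ≈ +1e-4·|e*|, bcc ≈
+2–3 %)? — a tie kills AllBadGap;
(b) interval-certify the smallest eigenvalue of the LJ hcp and fcc force-constant (Bloch) matrices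
on a coarse Brillouin-zone grid and the
elastic tensors at the box corners (a ≤ 0 value kills NearFieldConvexity; ACW 2025 report strict
positivity for fcc at N = 864);
(c) basin-hopping for an all-1/20-bad two-shell environment with site energy within g/2 of e* after
the best range-one transfer — if found,
the certificate radius is 3 shells and kill criterion (iii) fires. Not run here (hub is compute-free
for planners in this unit).

NUMBERS. LJ (r₀ = 1, min −1/12): nn distance a* ≈ 0.971, e* ≈ e_hcp ≈ −0.717 per particle, e_fcc −
e_hcp ≈ +1e-4·|e*|
(Stillinger2001); second shell √2·a* = 1.373 > Hales truncation 1.26·a* (bulk LJ fans are Hales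
fans); r⁻⁶ tail beyond 1.5a ≈ 24 % of
|e*|; near-threshold elastic gap at 5 % distortion ~ 0.3 % of |e*|; two-shell icosahedral deficit vs
hcp/fcc 4–6 % (card numerics,
uncertified); Hägg domination margin ≥ 287 on the box (PoissonBesselStacking numerics); box: a ∈
[47/50, 1], spacings/a ∈ [0.78, 0.85] ∋
√(2/3) = 0.8165; relaxed hcp c/a deviates from ideal by O(1e-4–1e-3) — the reason goodness is fixed
at 1/20 and coercivity is measured
against the layered family. Far-field tail on ONE site from δ-separated matter beyond radius R: ≤ ≈
(2/3)·δ⁻³(R−δ)⁻³ by ball packing (≤ 0.39 at δ = 1/3, R = 4 by the refuter's sharper shell count —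
headroom ×3.4 below |e*| ≈ 0.7175; but −0.0077/δ³ → −∞ at fixed R = 4, the refutation: −0.96 at δ =
0.2, −7.7 at δ = 0.1), hence R(δ) ≈ max(4, 1.2/δ); boundary slack C(δ) ≥ (250/12)·δ⁻⁶ + |e*|
suffices for one site (sum_inv_pow_six_le). Items at open: 13 (1 target, 4 cruxes, 7 supports, 1
assembly); after the 2026-08-16 repairs: 13 (target auto-cruxed, 6 live cruxes
FarFieldGapR/NearFieldConvexity/NearFarGlueR/PeriodicGivenLayered/HullBridge/WindowOptimality =
exactly the hypotheses of the crux-only deciding theorem `closes`, 5 supports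
AllBadGap/LayeredWindows/PeriodicWindows (open) and HullCriterion/CrysEnergyLimit (proved,
discharged inside `closes`), 1 assembly; the refuted FarFieldGap was dropped, 7 crux-kind entries
incl. the target = the cap).

DEFINITION REQUESTS. None new: fccTwoShellPattern / hcpTwoShellPattern / IsTwoShellGood (requested
by gen 1) have LANDED in
Literature.Geometry.DiscreteGeometry.TwoShellPatterns and are used; layered sets are written in the
inline format of stmt-3241
(triangularVec₁/₂, barlowOffset, haggLabel, layerNormal of BarlowStacking.lean). A named `layeredSet
A t a s z` definition would shorten
NearFieldConvexity / LayeredWindows and may be requested by the first prover.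

DEGENERATE CASES CHECKED. (Repair log 2026-08-16.) Against FarFieldGapR: (a) U = one isolated bad
particle, all other particles beyond R — tail ≤ (2/3)δ⁻³(R−δ)⁻³ → choose R(δ); (b) U = one bad
particle with neighbours within R — boundary, C(δ) ≥ (250/12)δ⁻⁶ + |e*|; (c) U = all particles —
this is AllBadGap (E ≥ N e* is free by periodisation, the gap is the crux); (d) U = thick bad slab
with a vacuum gap of width R and a dense δ-wall beyond — the wall recovers ≈ 0.03·ρ(δ)/R² per unit
area against the slab's positive free-surface energy (~0.24 per unit area for LJ close packings), so
R(δ) ≳ δ^{-3/2} closes it, and at δ = 1/3, R = 4 the margin is ×2.5–3.4; (e) small all-bad clusters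
(LJ₁₃ icosahedron: E − 13e* = +5.6 ≫ wall tail ≤ 3.6 even at the crude density bound); (f) dilute
bad gases and sc/bcc/expanded or compressed (>6.6 %) crystals pay ≥ 2 % of |e*| per particle
(Stillinger2001, BeterminSamajTravenec2022). NearFieldConvexity and CoerciveTwoShellGap are not
exposed to the dense-cloud mechanism: a good particle with empty 4-boundary forces a crystalline
patch of radius ≈ 5.4 around it and C(δ, η) is chosen after δ (cloud depression is a bounded
surface-order charge), and the target is a whole-configuration energy inequality.

Novelty: Searches (2026-08-15, this session): `lit frontier AtomisticToContinuum --since 2021` (30 rows;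
crystallization descendants only
arXiv:2407.20762 2-D arbitrary norm and arXiv:2604.19239 Kreutz–Ziereis polycrystals — nothing 3-D
for pure pairs); `lit bridges
AtomisticToContinuum --cross any` (30 rows, no certificate/crystal paper); `lit galaxy search
"crystallization conjecture" --star all`
(13 rows: Bétermin hal-01400869 2-D local lattice study, Kubin–Ponsiglione arXiv:2004.06820 hard
spheres + attractive Riesz tail ⇒
optimal packing, OWR 2018/49, Friedrich–Piovano–Stefanelli C₆₀); `lit vsearch` ×2 (held books only:
Alicandro–Braides–Cicalese–Solci 2023
p. 31 "stability under finite perturbations … proved only in dimension two"); `lit search --source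
all` ×2 → searchd unavailable (rc 75,
logged). Hub: negatives index (6; none restated), all nine open Crystallization route files read
(none is a near/far certificate
architecture), gen-1 record EqualityFreeCertificates.lean, retired HullPeriodicPoint.lean.
Nearest prior art found: HalesDSP2012 Ch. 6–7 / HalesEtAl2015 / Hales2012 (isolate the optimum,
certify strict inequalities — for
DENSITY); EMing2006 + FrieseckeTheil2002 + AyalaChoksiWirth2025 (harmonic/Cauchy–Born stability, LJ
fcc N = 864 validated numerics);
LauteriLuckhaus2017 (rigidity on good regions + per-defect charge, 2-D); in hub: FrustrationRangeLP
(retired; budgeted pointwise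
certificates), CrystalLocalRigidity (superseded; equality case certified), HullPeriodicPo  [refs: 2407.20762, 2604.19239, 2004.06820, HalesDSP2012, HalesEtAl2015, Hales2012, EMing2006, FrieseckeTheil2002, AyalaChoksiWirth2025, LauteriLuckhaus2017]

Barriers (technique_class: discharging-lp phonon-near-field local-energy-inequality): - technique_class: discharging-lp phonon-near-field local-energy-inequality
- Literature.Barriers.AtomisticToContinuum.TetrahedralFrustration: APPLIES to any pure single-cell
far-field inequality; evaded as Flyspeck evades it — boundary slack / transfers between neighbouring
particles and a two-shell score; it bites again exactly in NearFarGlue (g > C_tail + C_interface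
decides whether two shells suffice) — kill criterion (iii).
- Literature.Barriers.AtomisticToContinuum.IcosahedralClusters: APPLIES to first-shell-only
inequalities; evaded by the 18-point two-shell predicate and score (octahedral sites at √2·a
visible, where icosahedral centres lose 4–6 %); no finite-N exactness is used (small clusters are
all-surface = all-bad and satisfy FarFieldGap through the boundary slack).
- Literature.Barriers.AtomisticToContinuum.DecahedralSoftShell: not met — nothing is inferred from
ONE centre's soft first shell; goodness is a displacement match (a/20) of 18 points, the D5h axis
shell is far from both patterns hence BAD and is paid for by the far field, and the near field only
ever sees whole good REGIONS.
- Literature.Barriers.AtomisticToContinuum.FlexibleKissingArrangements: not met — flexible 12-shell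
families are branch-and-bound boxes in the far field (a dimension count) and the bridge applies the
global proved HalesDSP_layerPackings_holds only to everywhere-exact limits.
- Literature.Barriers.AtomisticToContinuum.KissingTwelveDegeneracy: respected — the certificate is
deliber

History (route lifecycle, newest last):
- 2026-08-16T03:49:10Z · AUTO-CRUX (backfill): CoerciveTwoShellGap — hypotheses of the deciding theorem that nothing in the route derives are cruxes (operator:999:586464)
- 2026-08-16T06:58:15Z · rev 3: restated Assembly (stmt-AtomisticToContinuum-13963) — route-repair step 2/3: restate Assembly 1:1 onto the repaired items (FarFieldGapR → NearFieldConvexity → NearFarGlueR → HullBridge → PeriodicGivenLayered → Hull (planner-rrefute-AtomisticToContinuum-PhononSla-69eb937b-0)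
- 2026-08-16T06:59:06Z · rev 4: dropped NearFarGlue — route-repair step 3/3: drop NearFarGlue (stmt-13959) — not load-bearing: its antecedent FarFieldGap is refuted-misstated (Lean ¬ pending p86053), so the implica (planner-rrefute-AtomisticToContinuum-PhononSla-69eb937b-0)
- 2026-08-16T08:42:39Z · rev 5: restated HullBridge (stmt-AtomisticToContinuum-13961) — route-repair crux-only STEP A of 2 (rbadge-03445f09; glue.non-crux-hypothesis): (i) RESTATE HullBridge self-contained — conclusion LayeredWindows unfolded verba (planner-rbadge-AtomisticToContinuum-PhononSlac-03445f09-0)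
- 2026-08-16T09:33:32Z · rev 7: dropped FarFieldGap — route-repair (rrepair-a83866ed, glue.unused-crux): DROP FarFieldGap (stmt-AtomisticToContinuum-13957) — not load-bearing and not gluable honestly: it is REFUTED (planner-rrepair-AtomisticToContinuum-PhononSla-a83866ed-0)
- 2026-08-26T14:17:48Z · DORMANT — reconciler: no traction for 6.7 d (last activity item-proof-filed at 2026-08-19T21:30:08Z); parked, not closed — `ledger route dormant route-AtomisticToContinuu (operator:999:1656052)

sub-problem: Crystallization · status: dormant · opened planner-plancard-AtomisticToContinuum-Crystal-6670e008-g2-0 2026-08-15T19:04:28Z · rev 7 · ledger route-AtomisticToContinuum-PhononSlackCertificates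
GENERATED by the gate from the ledger (D-0016/17). Provers cite these decls: `theorem foo : Summit.AtomisticToContinuum.Crystallization.Theses.PhononSlackCertificates.<Decl> := …` in Summits/AtomisticToContinuum/Crystallization/Theorems/<Name>.lean.
-/

namespace Summit.AtomisticToContinuum.Crystallization.Theses.PhononSlackCertificates

open scoped BigOperators Topology Manifold Classical MeasureTheory ProbabilityTheory Matrix InnerProductSpace ComplexConjugate ContinuousMap
open Filter Set Function TopologicalSpace MeasureTheory

attribute [summit_statement] _root_.Crystallization

/-- item stmt-AtomisticToContinuum-13956 · crux (kind.auto-crux: conjecture-grade) · rank 0 · open · by planner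
why it might fail: Fails iff 1/3-separated configurations with a positive FRACTION of 1/20-bad particles come within o(N) of N·e*: bulk polytetrahedral/Frank–Kasper order, a non-close-packed periodic competitor tied with hcp, or >5%-strained crystals at vanishing cost.
sources: BlancLewin2015, HalesDSP2012, Hales2012, EMing2006, LauteriLuckhaus2017, Literature.Barriers.AtomisticToContinuum.TetrahedralFrustration
[target] COERCIVE TWO-SHELL GAP at the fixed handover tolerance 1/20 (the card's H3 engine): for
every δ > 0 there is g > 0 such that every δ-separated N-point configuration x of ℝ³ has 𝓔_LJ(x) ≥
N·e* + g·#{i : particle i is not 1/20-good}, e* = ⨅ over periodic Q of e(Q); 1/20-good =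
IsTwoShellGood (1/20) (47/50) 1 (two-way a/20-match of the 3a/2-neighbourhood with a rotated fcc/hcp
18-point two-shell pattern at a scale a ∈ [47/50,1]; surface particles are bad). The g = 0 skeleton
N·e* ≤ 𝓔(x) is free by periodisation; the content is linear coercivity in the bad count.
Deliberately NOT quantified over ε → 0 (relaxed hcp has non-ideal c/a, so an ideal-pattern count at
every ε is false; see Numbers). -/
@[route_item "route-AtomisticToContinuum-PhononSlackCertificates", crux]
def CoerciveTwoShellGap : Prop :=
  ∀ δ : ℝ, 0 < δ → ∃ g : ℝ, 0 < g ∧ ∀ (N : ℕ) (x : Fin N → EuclideanSpace ℝ (Fin 3)), (∀ i j : Fin N, i ≠ j → δ ≤ dist (x i) (x j)) → (N : ℝ) * (⨅ Q : Literature.MathematicalPhysics.StatisticalMechanics.PeriodicConfiguration 3, Q.energyPerParticle Literature.MathematicalPhysics.StatisticalMechanics.lennardJones) + g * (Nat.card {i : Fin N // ¬ Literature.Geometry.DiscreteGeometry.IsTwoShellGood (1 / 20) (47 / 50) 1 x i} : ℝ) ≤ Literature.MathematicalPhysics.StatisticalMechanics.interactionEnergy Literature.MathematicalPhysics.StatisticalMechanics.lennardJones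 x

/-- item stmt-AtomisticToContinuum-14969 · crux · rank 2 · open · by planner
why it might fail: A thick all-bad bulk phase with energy density → e* (Frank–Kasper/σ/quasicrystal approximant tied with hcp within certificate error; near-threshold 5–8 % strains, gap ~cε²), or a vacuum-gap + dense-wall geometry whose tail beyond R(δ) beats the free-surface energy of U.
sources: Hales2012, HalesDSP2012, HalesFlyspeck2012, HalesEtAl2015, Stillinger2001, BeterminSamajTravenec2022
[crux] REPAIRED FAR FIELD WITH δ-DEPENDENT BOUNDARY SLACK (supersedes FarFieldGap
stmt-AtomisticToContinuum-13957, refuted-misstated: with the slack radius FIXED at 4 under ∀δ, one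
isolated 1/20-bad particle with EMPTY 4-boundary inside an arbitrarily dense δ-separated cloud has
site energy → −∞ < e* + g; Lean ¬FarFieldGap = Theorems.PhononSlackCertificatesFarFieldGap_refuted,
p86053; paper witnesses FarFieldGap_counterexample.md, EVIDENCE-stmt-13957-g2.md). For every δ > 0
there are g > 0, C and a slack radius R — all three chosen after δ — such that for every δ-separated
configuration x and every set U of 1/20-BAD particles, Σ_{i∈U} (e_i − e*) ≥ g·#U − C·#{i ∈ U : some
particle outside U lies within distance R of x_i}, where e_i = ½ Σ_{j≠i} V(|x_i − x_j|) is the site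
energy and e* = ⨅ over periodic Q of e(Q) (a genuine infimum: CrysPeriodicBddBelow 0714 is proved).
The recorded witnesses are defeated by R(δ) ≈ max(4, 1.2/δ): the r⁻⁶ tail of ANY δ-separated matter
beyond R lowers one site energy by at most ≈ (2/3)·δ⁻³(R−δ)⁻³ < |e*| − g, and boundary particles are
covered by C ≥ (250/12)·δ⁻⁶ + |e*| (sum_inv_pow_six_le); a dense wall beyond R facing a vacuum gap
of width R recovers -/
@[route_item "route-AtomisticToContinuum-PhononSlackCertificates", crux]
def FarFieldGapR : Prop :=
  ∀ δ : ℝ, 0 < δ → ∃ g : ℝ, 0 < g ∧ ∃ C R : ℝ, ∀ (N : ℕ) (x : Fin N → EuclideanSpace ℝ (Fin 3)), (∀ i j : Fin N, i ≠ j → δ ≤ dist (x i) (x j)) → ∀ U : Finset (Fin N), (∀ i ∈ U, ¬ Literature.Geometry.DiscreteGeometry.IsTwoShellGood (1 / 20) (47 / 50) 1 x i) → g * (U.card : ℝ) - C * (Nat.card {i : Fin N // i ∈ U ∧ ∃ j : Fin N, j ∉ U ∧ dist (x j) (x i) ≤ R} : ℝ) ≤ ∑ i ∈ U, ((1 / 2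 : ℝ) * (∑ j ∈ Finset.univ.erase i, Literature.MathematicalPhysics.StatisticalMechanics.lennardJones (dist (x i) (x j))) - (⨅ Q : Literature.MathematicalPhysics.StatisticalMechanics.PeriodicConfiguration 3, Q.energyPerParticle Literature.MathematicalPhysics.StatisticalMechanics.lennardJones))

/-- item stmt-AtomisticToContinuum-13958 · crux · rank 3 · open · by planner
why it might fail: Needs UNIFORM phonon+elastic coercivity of every relaxed Barlow polytype (not just hcp/fcc) on the box and a convexity radius covering 5% two-shell distortions; a soft shear branch, or good-preserving incipient slip with sub-quadratic cost, refutes it.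
sources: EMing2006, ELi2008, FrieseckeTheil2002, FrieseckeJamesMuller2002, AyalaChoksiWirth2025, Theil2006
[crux] NEAR FIELD = CONVEXITY OVER THE LAYERED FAMILY (E1–E2 of the card, relaxation-tolerant): for
every δ > 0 and η > 0 there are c > 0 and C such that for every δ-separated x and every set Ω of
1/20-GOOD particles, Σ_{i∈Ω} (e_i − e*) ≥ c·#{i ∈ Ω : the radius-2 ball of x_i is NOT two-way
η-matched, after a translation, to a layered set} − C·#{i ∈ Ω : some particle outside Ω lies within
4 of x_i}; layered set = rigid image of triangular layers of spacing a ∈ [47/50,1] in hole registry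
along a Hägg word with free interlayer spacings in [39a/50, 17a/20] (the format of LayeredWindows,
stmt-3241). Uniform in-plane compression, c/a relaxation and restacking cost nothing here (they are
layered); shear, strain gradients, optical shuffles and defects pay. Intended proof: certified
positive-definiteness of LJ force constants/elastic tensor of the relaxed polytypes (interval Bloch
eigenvalues; ACW 2025 did fcc N = 864) + geometric-nonlinear expansion in co-rotated frames (E–Ming
/ FJM) with boundary layers charged to C. [difficulty: XL] -/
@[route_item "route-AtomisticToContinuum-PhononSlackCertificates", crux]
def NearFieldConvexity : Prop :=
  ∀ δ : ℝ, 0 < δ → ∀ η : ℝ, 0 < η → ∃ c : ℝ, 0 < c ∧ ∃ C : ℝ, ∀ (N : ℕ) (x : Fin N → EuclideanSpace ℝ (Fin 3)), (∀ i j : Fin N, i ≠ j → δ ≤ dist (x i) (x j)) → ∀ Ω : Finset (Fin N), (∀ i ∈ Ω, Literature.Geometry.DiscreteGeometry.IsTwoShellGood (1 / 20) (47 / 50) 1 x i) → c * (Nat.card {i : Fin N // i ∈ Ω ∧ ¬ (∃ (A : EuclideanSpace ℝ (Fin 3) →ₗᵢ[ℝ] EuclideanSpace ℝ (Fin 3))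 (t : EuclideanSpace ℝ (Fin 3)) (a : ℝ) (s : ℤ → ℤ) (z : ℤ → ℝ), 47 / 50 ≤ a ∧ a ≤ 1 ∧ Literature.MathematicalPhysics.StatisticalMechanics.IsHaggSeq s ∧ (∀ m : ℤ, 39 / 50 * a ≤ z (m + 1) - z m ∧ z (m + 1) - z m ≤ 17 / 20 * a) ∧ let S : Set (EuclideanSpace ℝ (Fin 3)) := {p | ∃ m i j : ℤ, p = A (((i : ℝ) • Literature.MathematicalPhysics.StatisticalMechanics.triangularVec₁ a) + ((j : ℝ) • Literature.MathematicalPhysics.StatisticalMechanics.triangularVec₂ a) + ((Literature.MathematicalPhysics.StatisticalMechanics.haggLabel s m : ℝ) • Literature.MathematicalPhysics.StatisticalMechanics.barlowOffset a) + (z m • Literature.MathematicalPhysics.StatisticalMechanics.layerNormal 1))}; (∀ j : Fin N, dist (x j) (x i) ≤ 2 → ∃ p ∈ S, dist (x j + t) p ≤ η) ∧ (∀ p ∈ S, dist p (x i + t) ≤ 2 → ∃ j : Fin N, dist (x j + t) p ≤ η))} : ℝ) - C * (Nat.card {i : Fin N // i ∈ Ω ∧ ∃ j : Fin N, j ∉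 Ω ∧ dist (x j) (x i) ≤ 4} : ℝ) ≤ ∑ i ∈ Ω, ((1 / 2 : ℝ) * (∑ j ∈ Finset.univ.erase i, Literature.MathematicalPhysics.StatisticalMechanics.lennardJones (dist (x i) (x j))) - (⨅ Q : Literature.MathematicalPhysics.StatisticalMechanics.PeriodicConfiguration 3, Q.energyPerParticle Literature.MathematicalPhysics.StatisticalMechanics.lennardJones))

/-- item stmt-AtomisticToContinuum-14970 · crux · rank 4 · open · by planner
why it might fail: The levy: flat boundary constants C (near, radius 4) and C'·K(δ,R(δ)) (far, radius R ≳ 1/δ) exceed the near-threshold gap g ~ c/400 at mild or point-like defects; unless interface charges scale with the actual distortion, two shells do not close and the radius must grow to 3 shells.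
sources: HalesDSP2012, LauteriLuckhaus2017, Theil2006, FlatleyTheil2015, Literature.Barriers.AtomisticToContinuum.TetrahedralFrustration
[crux] RE-POINTED GLUING / LEVY PROTOCOL (supersedes NearFarGlue stmt-AtomisticToContinuum-13959,
vacuously provable once its antecedent FarFieldGap was refuted): FarFieldGapR → NearFieldConvexity →
CoerciveTwoShellGap. Partition particles into good Ω and bad B; the near field gives Σ_Ω(e_i − e*) ≥
−C·#∂₄Ω ≥ −C·K(δ)·#B, the repaired far field gives Σ_B(e_i − e*) ≥ g#B − C'·#∂_R B with R = R(δ) (R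
= 4 at δ = 1/3); since thin bad sets are all boundary on both sides this is NOT bookkeeping: the
implication must improve the flat boundary charges near mild and point-like defects to charges
proportional to the actual distortion (smooth defect measure, transfers across the interface, r⁻⁶
tail merged into the slack) so that a positive g survives — the inequality g > C_tail + C_interface
fixes the certificate radius (expected 2–2.5 shells). [deps: FarFieldGapR, NearFieldConvexity]
[difficulty: L] -/
@[route_item "route-AtomisticToContinuum-PhononSlackCertificates", crux]
def NearFarGlueR : Prop :=
  FarFieldGapR → NearFieldConvexity → CoerciveTwoShellGap

/-- item stmt-AtomisticToContinuum-11779 · crux · rank 5 · closed · proved by Summit.AtomisticToContinuum.Crystallization.Theorems.LayeredHull.PeriodicGivenLayered_of @ 3a4fd92cd160 (prover) · by planner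
why it might fail: Only a SYNDETIC fault pattern in every layered energy-minimising local limit defeats it (aperiodic optimal LJ stacking); rests on Hägg domination J₂<0, Σ(k−1)|J_k| ≤ |J₂|/2 (numerics margin 287, uncertified) + cut-and-paste in the hull.
sources: RadinSchulman1983, PartayOrtnerCsanyi2017, Stillinger2001, LoachAckland2017, BlancLewin2015, stmt-AtomisticToContinuum-3063
[crux] PERIODIC GIVEN LAYERED (card items H2/H3 "zero fault density suffices"; stacking selection
INSIDE THE HULL): for every sequence of LJ ground states, layered windows at every scale in the
sense of LayeredWindows (same a, A, t, s, z data) imply periodic windows at every scale in the sense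
of PeriodicWindows (one periodic P; expected relaxed hcp = a rotated barlowPeriodicConfiguration of
the alternating word, but ANY periodic polytype is allowed). Intended mechanism: Hägg domination on
the box (LjRegistryDomination stmt-3063 feeding the Peierls count HaggDominationAllRanges stmt-0737)
prices every non-alternating letter pair at ≥ c > 0 per unit area; dislocation-loop surgery at
radius ρ ≫ C/c shows the fault density of an energy-minimising layered limit is zero; fault-free
slabs of every thickness relax exponentially to constant spacing; compactness of O(3) × [47/50,1]
fixes one P. Only a SYNDETIC fault pattern in every layered limit defeats it. [deps: LayeredWindows]
[difficulty: L] -/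
@[route_item "route-AtomisticToContinuum-PhononSlackCertificates", crux]
def PeriodicGivenLayered : Prop :=
  ∀ x : (N : ℕ) → (Fin N → EuclideanSpace ℝ (Fin 3)), (∀ N, Literature.MathematicalPhysics.StatisticalMechanics.IsGroundState Literature.MathematicalPhysics.StatisticalMechanics.lennardJones (x N)) → (∃ a : ℝ, 47 / 50 ≤ a ∧ a ≤ 1 ∧ ∀ R ε : ℝ, 0 < ε → ∃ᶠ N in Filter.atTop, ∃ (A : EuclideanSpace ℝ (Fin 3) →ₗᵢ[ℝ] EuclideanSpace ℝ (Fin 3)) (t : EuclideanSpace ℝ (Fin 3)) (s : ℤ → ℤ) (z : ℤ → ℝ), Literature.MathematicalPhysics.StatisticalMechanics.IsHaggSeq s ∧ (∀ m : ℤ, 39 / 50 * a ≤ z (m + 1) - z m ∧ z (m + 1) - z m ≤ 17 / 20 * a) ∧ let S : Set (EuclideanSpace ℝ (Fin 3)) := {p | ∃ m i j : ℤ, p = A (((i : ℝ) • Literature.MathematicalPhysics.StatisticalMechanics.triangularVec₁ a) + ((j : ℝ) • Literature.MathematicalPhysics.StatisticalMechanics.triangularVec₂ a) + ((Literature.MathematicalPhysics.StatisticalMechanics.haggLabel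 s m : ℝ) • Literature.MathematicalPhysics.StatisticalMechanics.barlowOffset a) + (z m • Literature.MathematicalPhysics.StatisticalMechanics.layerNormal 1))}; (∀ p ∈ S, ‖p‖ ≤ R → ∃ i : Fin N, dist (x N i + t) p ≤ ε) ∧ (∀ i : Fin N, ‖x N i + t‖ ≤ R → ∃ p ∈ S, dist (x N i + t) p ≤ ε)) → ∃ P : Literature.MathematicalPhysics.StatisticalMechanics.PeriodicConfiguration 3, ∀ R ε : ℝ, 0 < ε → ∃ᶠ N in Filter.atTop, ∃ t : EuclideanSpace ℝ (Fin 3), (∀ s ∈ P.points, ‖s‖ ≤ R → ∃ i : Fin N, dist (x N i + t) s ≤ ε) ∧ (∀ i : Fin N, ‖x N i + t‖ ≤ R → ∃ s ∈ P.points, dist (x N i + t) s ≤ ε)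

-- `PeriodicGivenLayered` holds: proved by `Summit.AtomisticToContinuum.Crystallization.Theorems.LayeredHull.PeriodicGivenLayered_of` @ 3a4fd92cd160 (its module imports this route file, so no `_holds` link can be stated here).

/-- item stmt-AtomisticToContinuum-13962 · crux · rank 9 · closed · proved by Summit.AtomisticToContinuum.Crystallization.Theorems.windowOptimality_proof @ 0fd4a225e0d9 (prover) · by planner
why it might fail: Finite-N cut and paste: Σ_window e_i ≥ M·e(P) − C_P·R² must follow from two-way ε-matching by TRANSLATES alone (uniform continuity of LJ site energies at separation 1/3, summable r⁻⁶ tails), and an M-block of any periodic Q must cost ≤ M·e(Q)+C_Q·M^{2/3}; the O(R²) interface terms are the exposure.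
sources: BlancLewin2015, Theil2006, Suto2006
[support] WINDOWS OF GROUND STATES ARE OPTIMAL (new; replaces the separate periodic-minimum item
0627): if a periodic P is two-way ε-matched on B(0,R) by translates of LJ ground states frequently
in N for every R, ε, then e(P) is a LEAST element of the energy per particle over all periodic
configurations. Proof: cut and paste — delete the ~ρR³ window particles (removes Σ_{window} e_i +
½·interface ≥ M e(P) − C R² − o(M)) and add, far away, an M-point block of any periodic Q (energy ≤
M e(Q) + C_Q R²); ground-state minimality gives M e(P) ≤ M e(Q) + O(R²); only small ε is used
(matching is then a bijection by the 1/3-separation), large-ε or unmatched P make the hypothesis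
vacuous. [difficulty: L] -/
@[route_item "route-AtomisticToContinuum-PhononSlackCertificates", crux]
def WindowOptimality : Prop :=
  ∀ x : (N : ℕ) → (Fin N → EuclideanSpace ℝ (Fin 3)), (∀ N, Literature.MathematicalPhysics.StatisticalMechanics.IsGroundState Literature.MathematicalPhysics.StatisticalMechanics.lennardJones (x N)) → ∀ P : Literature.MathematicalPhysics.StatisticalMechanics.PeriodicConfiguration 3, (∀ R ε : ℝ, 0 < ε → ∃ᶠ N in Filter.atTop, ∃ t : EuclideanSpace ℝ (Fin 3), (∀ s ∈ P.points, ‖s‖ ≤ R → ∃ i : Fin N, dist (x N i + t) s ≤ ε) ∧ (∀ i : Fin N, ‖x N i + t‖ ≤ R → ∃ s ∈ P.points, dist (x N i + t) s ≤ ε)) → IsLeast (Set.range fun Q : Literature.MathematicalPhysics.StatisticalMechanics.PeriodicConfiguration 3 => Q.energyPerParticle Literature.MathematicalPhysics.StatisticalMechanics.lennardJones) (P.energyPerParticle Literature.MathematicalPhysics.StatisticalMechanics.lennardJones)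

-- `WindowOptimality` holds: proved by `Summit.AtomisticToContinuum.Crystallization.Theorems.windowOptimality_proof` @ 0fd4a225e0d9 (its module imports this route file, so no `_holds` link can be stated here).

-- earlier HullBridge (stmt-AtomisticToContinuum-13961, replaced 2026-08-16T08:42:39Z -> stmt-AtomisticToContinuum-15147): retired by None — CoerciveTwoShellGap → NearFieldConvexity → CrysEnergyLimit → LayeredWindows
/-- item stmt-AtomisticToContinuum-15147 · crux · rank 9 · closed · proved by Summit.AtomisticToContinuum.Crystallization.Theorems.HullBridgeExact.hullBridge_proof @ be932d432da9 (prover) · by planner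
why it might fail: Local-to-global: η-layered 2-balls must integrate to ONE layered set on B(0,R), but the stacking normal switches silently through fcc-like regions (non-parallel twins, hcp|fcc|hcp′ sandwiches are locally layered everywhere): needs a margin ball B(0,3R) + a junction-defect lemma, and η after (R,ε).
sources: BlancLewin2015, FlatleyTheil2015, FrieseckeJamesMuller2002, HalesDSP2012
[crux] BRIDGE — soft compactness + local-to-global integration (restated 2026-08-16 for the
crux-only deciding theorem, D-0027 §2.1: the conclusion LayeredWindows stmt-11778 is UNFOLDED
verbatim so the decl is self-contained — `HullBridge ↔ (CoerciveTwoShellGap → NearFieldConvexity →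
LayeredWindows)` is Iff.rfl — and the PROVED antecedent CrysEnergyLimit 0626 is dropped, provers use
crysEnergyLimit_proof directly; supersedes stmt-13961): CoerciveTwoShellGap → NearFieldConvexity →
every sequence of LJ ground states has layered windows at every scale (one in-layer spacing a ∈
[47/50,1]; for every R, ε, frequently in N, a rigid motion of x^N is two-way ε-matched on B(0,R)
with triangular layers in hole registry along a free Hägg word with free interlayer spacings in
[39a/50, 17a/20]). Sketch: ground states are δ-separated (LennardJonesMinimalDistance_holds) and
E(N) ≤ N e* + o(N) (crysEnergyLimit_proof), so CoerciveTwoShellGap gives #bad = o(N);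
NearFieldConvexity at FIXED η with Ω = good particles gives #non-η-layered good = o(N) (site
energies ≥ −C(δ) on bad sites, #∂₄Ω ≤ K(δ)·#bad); packing gives, for N ≥ N₀(R, η), a particle whose
MARGIN ball B(x_p, 3R) holds no bad and no non-η-l -/
@[route_item "route-AtomisticToContinuum-PhononSlackCertificates", crux]
def HullBridge : Prop :=
  CoerciveTwoShellGap → NearFieldConvexity → (∀ x : (N : ℕ) → (Fin N → EuclideanSpace ℝ (Fin 3)), (∀ N, Literature.MathematicalPhysics.StatisticalMechanics.IsGroundState Literature.MathematicalPhysics.StatisticalMechanics.lennardJones (x N)) → ∃ a : ℝ, 47 / 50 ≤ a ∧ a ≤ 1 ∧ ∀ R ε : ℝ, 0 < ε → ∃ᶠ N in Filter.atTop, ∃ (A : EuclideanSpace ℝ (Fin 3) →ₗᵢ[ℝ] EuclideanSpace ℝ (Fin 3)) (t : EuclideanSpace ℝ (Fin 3)) (s : ℤ → ℤ) (z : ℤ → ℝ), Literature.MathematicalPhysics.StatisticalMechanics.IsHaggSeq s ∧ (∀ m : ℤ, 39 / 50 * a ≤ z (m + 1) - z m ∧ z (m + 1) - z m ≤ 17 /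 20 * a) ∧ let S : Set (EuclideanSpace ℝ (Fin 3)) := {p | ∃ m i j : ℤ, p = A (((i : ℝ) • Literature.MathematicalPhysics.StatisticalMechanics.triangularVec₁ a) + ((j : ℝ) • Literature.MathematicalPhysics.StatisticalMechanics.triangularVec₂ a) + ((Literature.MathematicalPhysics.StatisticalMechanics.haggLabel s m : ℝ) • Literature.MathematicalPhysics.StatisticalMechanics.barlowOffset a) + (z m • Literature.MathematicalPhysics.StatisticalMechanics.layerNormal 1))}; (∀ p ∈ S, ‖p‖ ≤ R → ∃ i : Fin N, dist (x N i + t) p ≤ ε) ∧ (∀ i : Fin N, ‖x N i + t‖ ≤ R → ∃ p ∈ S, dist (x N i + t) p ≤ ε))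

-- `HullBridge` holds: proved by `Summit.AtomisticToContinuum.Crystallization.Theorems.HullBridgeExact.hullBridge_proof` @ be932d432da9 (its module imports this route file, so no `_holds` link can be stated here).

/-- item stmt-AtomisticToContinuum-0626 · support · rank 9 · closed · proved by Summit.AtomisticToContinuum.Crystallization.Theorems.crysEnergyLimit_proof @ de27d46e58f4 (prover) · by planner
sources: BlancLewin2015
Energetic crystallization: E(N)/N converges to the infimum over periodic (multi-lattice)
configurations of the LJ energy per particle in d = 3. Lower bound liminf ≥ ⨅ is the content ((a)
local optimality + (d) + surface term O(N^{2/3})); upper bound is filed separately. -/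
@[route_item "route-AtomisticToContinuum-PhononSlackCertificates"]
def CrysEnergyLimit : Prop :=
  Filter.Tendsto (fun N : ℕ => Literature.MathematicalPhysics.StatisticalMechanics.groundStateEnergy Literature.MathematicalPhysics.StatisticalMechanics.lennardJones 3 N / N) Filter.atTop (nhds (⨅ Q : Literature.MathematicalPhysics.StatisticalMechanics.PeriodicConfiguration 3, Q.energyPerParticle Literature.MathematicalPhysics.StatisticalMechanics.lennardJones))

/-- `CrysEnergyLimit` holds: proved by `Summit.AtomisticToContinuum.Crystallization.Theorems.crysEnergyLimit_proof` @ de27d46e58f4. -/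
theorem CrysEnergyLimit_holds : CrysEnergyLimit := _root_.Summit.AtomisticToContinuum.Crystallization.Theorems.crysEnergyLimit_proof

/-- item stmt-AtomisticToContinuum-11778 · support · rank 9 · open · by planner
sources: HalesDSP2012, BlancLewin2015
[crux] LAYERED WINDOWS (card item H2 "layering of one limit"; the genuinely 3-D crux): for every
sequence of LJ ground states x^N there is an in-layer spacing a ∈ [47/50, 1] such that for every R
and ε > 0, frequently in N, there are a linear isometry A, a translation t, a Hägg word s (IsHaggSeq
s) and layer heights z : ℤ → ℝ with all increments z(m+1) − z(m) ∈ [39a/50, 17a/20] (box B of route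
PoissonBesselStacking, so its typed LjRegistryDomination stmt-3063 applies verbatim) such that x^N +
t is two-way ε-matched on B(0,R) with the rigid image under A of the layered set S = { i·u(a) +
j·v(a) + L_s(m)·w(a) + z(m)·e₃ } (triangular layers of spacing a, consecutive layers in distinct
hole positions coded by haggLabel s, FREE interlayer spacings, so faulted and polytypic stackings
are admitted; one window per scale infinitely often, nothing for all but o(N) particles). By
compactness of [47/50,1], O(3) and the word/spacing spaces, "∃ a" outside the (R, ε) quantifiers is
equivalent to choosing a per window. [difficulty: XL] -/
@[route_item "route-AtomisticToContinuum-PhononSlackCertificates"]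
def LayeredWindows : Prop :=
  ∀ x : (N : ℕ) → (Fin N → EuclideanSpace ℝ (Fin 3)), (∀ N, Literature.MathematicalPhysics.StatisticalMechanics.IsGroundState Literature.MathematicalPhysics.StatisticalMechanics.lennardJones (x N)) → ∃ a : ℝ, 47 / 50 ≤ a ∧ a ≤ 1 ∧ ∀ R ε : ℝ, 0 < ε → ∃ᶠ N in Filter.atTop, ∃ (A : EuclideanSpace ℝ (Fin 3) →ₗᵢ[ℝ] EuclideanSpace ℝ (Fin 3)) (t : EuclideanSpace ℝ (Fin 3)) (s : ℤ → ℤ) (z : ℤ → ℝ), Literature.MathematicalPhysics.StatisticalMechanics.IsHaggSeq s ∧ (∀ m : ℤ, 39 / 50 * a ≤ z (m + 1) - z m ∧ z (m + 1) - z m ≤ 17 / 20 * a) ∧ let S : Set (EuclideanSpace ℝ (Fin 3)) := {p | ∃ m i j : ℤ, p = A (((i : ℝ) • Literature.MathematicalPhysics.StatisticalMechanics.triangularVec₁ a) + ((j : ℝ) • Literature.MathematicalPhysics.StatisticalMechanics.triangularVec₂ a) + ((Literature.MathematicalPhysics.StatisticalMechanics.haggLabel s m : ℝ) • Literature.MathematicalPhysics.StatisticalMechanics.barlowOffset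 a) + (z m • Literature.MathematicalPhysics.StatisticalMechanics.layerNormal 1))}; (∀ p ∈ S, ‖p‖ ≤ R → ∃ i : Fin N, dist (x N i + t) p ≤ ε) ∧ (∀ i : Fin N, ‖x N i + t‖ ≤ R → ∃ p ∈ S, dist (x N i + t) p ≤ ε)

/-- item stmt-AtomisticToContinuum-13960 · support · rank 9 · open · by planner
sources: Hales2012, Stillinger2001, BeterminSamajTravenec2022
[support] Special case ∂U = ∅ of FarFieldGap and the far field's cheapest falsifier (stmt-3950
restated with the landed predicate IsTwoShellGood): δ-separated configurations in which EVERY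
particle is 1/20-bad have 𝓔 ≥ N·(e* + g(δ)), g > 0. [difficulty: XL] -/
@[route_item "route-AtomisticToContinuum-PhononSlackCertificates", crux]
def AllBadGap : Prop :=
  ∀ δ : ℝ, 0 < δ → ∃ g : ℝ, 0 < g ∧ ∀ (N : ℕ) (x : Fin N → EuclideanSpace ℝ (Fin 3)), (∀ i j : Fin N, i ≠ j → δ ≤ dist (x i) (x j)) → (∀ i : Fin N, ¬ Literature.Geometry.DiscreteGeometry.IsTwoShellGood (1 / 20) (47 / 50) 1 x i) → (N : ℝ) * ((⨅ Q : Literature.MathematicalPhysics.StatisticalMechanics.PeriodicConfiguration 3, Q.energyPerParticle Literature.MathematicalPhysics.StatisticalMechanics.lennardJones) + g) ≤ Literature.MathematicalPhysics.StatisticalMechanics.interactionEnergy Literature.MathematicalPhysics.StatisticalMechanics.lennardJones x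

/-- item stmt-AtomisticToContinuum-3240 · support · rank 9 · open · by planner
sources: BlancLewin2015
[target] PERIODIC WINDOWS (finite form of "some local limit of translated LJ ground states has a
non-empty periodic configuration in its orbit closure"): for every sequence of Lennard-Jones ground
states x^N in ℝ³ there is one periodic configuration P such that for every R and every ε > 0,
frequently in N, some translate x^N + t is two-way ε-matched with P.points on the closed ball B(0,R)
(every site of P in the ball has a particle within ε and every particle in the ball has a site
within ε). Equivalent to IsCrystallizing lennardJones 3 (HullCriterion + HullCriterionConverse). -/
@[route_item "route-AtomisticToContinuum-PhononSlackCertificates"]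
def PeriodicWindows : Prop :=
  ∀ x : (N : ℕ) → (Fin N → EuclideanSpace ℝ (Fin 3)), (∀ N, Literature.MathematicalPhysics.StatisticalMechanics.IsGroundState Literature.MathematicalPhysics.StatisticalMechanics.lennardJones (x N)) → ∃ P : Literature.MathematicalPhysics.StatisticalMechanics.PeriodicConfiguration 3, ∀ R ε : ℝ, 0 < ε → ∃ᶠ N in Filter.atTop, ∃ t : EuclideanSpace ℝ (Fin 3), (∀ s ∈ P.points, ‖s‖ ≤ R → ∃ i : Fin N, dist (x N i + t) s ≤ ε) ∧ (∀ i : Fin N, ‖x N i + t‖ ≤ R → ∃ s ∈ P.points, dist (x N i + t) s ≤ ε)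

/-- item stmt-AtomisticToContinuum-3243 · support · rank 9 · closed · proved by Summit.AtomisticToContinuum.Crystallization.Theorems.PrestressSplitKorn.stub_hullCriterion @ fa5252dfcb52 (prover) · by planner
sources: BlancLewin2015
[support] HULL CRITERION (card H1, soft, provable now): PeriodicWindows ⇒ IsCrystallizing
lennardJones 3. Proof: Filter.extraction_of_frequently_atTop over (R, ε) = (j+1, 1/(j+1)) gives φ
strictly increasing and translations τ_j; the proved LennardJonesMinimalDistance_holds (δ = 1/3)
gives uniform separation of the translated ground states;
PeriodicConfiguration.tendsto_sum_of_eventually_near' (CrystallizationLocalLimit.lean) gives the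
local convergence with multiplicity m ≡ 1. [difficulty: provable-now] -/
@[route_item "route-AtomisticToContinuum-PhononSlackCertificates"]
def HullCriterion : Prop :=
  PeriodicWindows → Literature.MathematicalPhysics.StatisticalMechanics.IsCrystallizing Literature.MathematicalPhysics.StatisticalMechanics.lennardJones 3

/-- `HullCriterion` holds: proved by `Summit.AtomisticToContinuum.Crystallization.Theorems.PrestressSplitKorn.stub_hullCriterion` @ fa5252dfcb52. -/
theorem HullCriterion_holds : HullCriterion := _root_.Summit.AtomisticToContinuum.Crystallization.Theorems.PrestressSplitKorn.stub_hullCriterion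

-- earlier Assembly (stmt-AtomisticToContinuum-13963, replaced 2026-08-16T06:58:15Z -> stmt-AtomisticToContinuum-14971): retired by None — FarFieldGap → NearFieldConvexity → NearFarGlue → HullBridge → PeriodicGivenLayered → HullCriterion → WindowOptimality → CrysEnergyLimit → _root_.Crystallization
/-- item stmt-AtomisticToContinuum-14971 · assembly · rank 1 · closed · proved by Summit.AtomisticToContinuum.Crystallization.Theorems.phononSlackCertificates_assembly_proof @ 4fea702828e0 (prover) · by planner
sources: BlancLewin2015, HalesDSP2012
[assembly] FarFieldGapR → NearFieldConvexity → NearFarGlueR → HullBridge → PeriodicGivenLayered →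
HullCriterion → WindowOptimality → CrysEnergyLimit → Crystallization (restated 2026-08-16 after the
FarFieldGap repair: the first and third antecedents were FarFieldGap — refuted-misstated, p86053 —
and the then-vacuous NearFarGlue; proof = the body of the deciding theorem `closes`, pure logic plus
the proved Literature theorem LennardJonesGroundStatesExist_holds). -/
@[route_item "route-AtomisticToContinuum-PhononSlackCertificates"]
def Assembly : Prop :=
  FarFieldGapR → NearFieldConvexity → NearFarGlueR → HullBridge → PeriodicGivenLayered → HullCriterion → WindowOptimality → CrysEnergyLimit → _root_.Crystallization

-- `Assembly` holds: proved by `Summit.AtomisticToContinuum.Crystallization.Theorems.phononSlackCertificates_assembly_proof` @ 4fea702828e0 (its module imports this route file, so no `_holds` link can be stated here).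

/-! D-0027 §2.1 — DECIDING THEOREM (planner-authored via `route open/edit --closes-file`; by planner-rbadge-AtomisticToContinuum-PhononSlac-03445f09-0 2026-08-16T08:42:39Z):
its hypotheses are this route's items and its conclusion the sub-problem Statement (glue_lint), and it elaborates with this file. -/

@[closes "route-AtomisticToContinuum-PhononSlackCertificates"] theorem closes (h_FarFieldGapR : FarFieldGapR) (h_NearFieldConvexity : NearFieldConvexity)
    (h_NearFarGlueR : NearFarGlueR) (h_PeriodicGivenLayered : PeriodicGivenLayered)
    (h_HullBridge : HullBridge) (h_WindowOptimality : WindowOptimality) :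
    _root_.Crystallization := by
  -- Route repair 2026-08-16 (planner-rbadge-…-03445f09-0, glue.non-crux-hypothesis): the deciding theorem now assumes
  -- CRUX items only — the four live cruxes FarFieldGapR, NearFieldConvexity, NearFarGlueR, PeriodicGivenLayered and the
  -- two content-bearing glue statements HullBridge and WindowOptimality (re-badged crux in the same edit). The PROVED items
  -- HullCriterion (stub_hullCriterion) and CrysEnergyLimit (crysEnergyLimit_proof) are discharged inside the proof through
  -- their `_holds` theorems; the derived statements CoerciveTwoShellGap (target), LayeredWindows, PeriodicWindows and the
  -- special case AllBadGap are obtained or unused here and are NOT hypotheses; the refuted FarFieldGap never enters.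
  -- (1) the coercive two-shell gap (thesis X₁), from the repaired far field and the near field through the levy/glue crux
  have hCG : CoerciveTwoShellGap := h_NearFarGlueR h_FarFieldGapR h_NearFieldConvexity
  -- (2) layered windows of every sequence of ground states (bridge crux HullBridge, restated self-contained: LayeredWindows unfolded,
  --     the proved energy limit no longer an antecedent)
  have hLW : LayeredWindows := h_HullBridge hCG h_NearFieldConvexity
  -- (3) stacking selection inside the hull: layered windows ⇒ periodic windows
  have hPW : PeriodicWindows := fun y hy => h_PeriodicGivenLayered y hy (hLW y hy)
  -- (4) positional conjunct (ii) via the hull criterion (proved in tree, discharged here)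
  have hHC : HullCriterion := HullCriterion_holds
  have hpos : Literature.MathematicalPhysics.StatisticalMechanics.IsCrystallizing
      Literature.MathematicalPhysics.StatisticalMechanics.lennardJones 3 := hHC hPW
  -- (5) energetic conjunct (i): ground states exist for every N (proved Literature theorem), their periodic window P is a
  -- least-energy periodic configuration by WindowOptimality, hence ⨅ = e(P), and E(N)/N → e(P) by the proved energy limit.
  have hex : Literature.MathematicalPhysics.StatisticalMechanics.LennardJonesGroundStatesExist :=
    Literature.MathematicalPhysics.StatisticalMechanics.LennardJonesGroundStatesExist_holds
  obtain ⟨x, hx⟩ : ∃ x : (N : ℕ) → (Fin N → EuclideanSpace ℝ (Fin 3)), ∀ N,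
      Literature.MathematicalPhysics.StatisticalMechanics.IsGroundState
        Literature.MathematicalPhysics.StatisticalMechanics.lennardJones (x N) :=
    ⟨fun N => (hex N).choose, fun N => (hex N).choose_spec⟩
  obtain ⟨P, hP⟩ := hPW x hx
  have hleast : IsLeast (Set.range fun Q : Literature.MathematicalPhysics.StatisticalMechanics.PeriodicConfiguration 3 =>
      Q.energyPerParticle Literature.MathematicalPhysics.StatisticalMechanics.lennardJones)
      (P.energyPerParticle Literature.MathematicalPhysics.StatisticalMechanics.lennardJones) := h_WindowOptimality x hx P hP
  have hinf : (⨅ Q : Literature.MathematicalPhysics.StatisticalMechanics.PeriodicConfiguration 3,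
      Q.energyPerParticle Literature.MathematicalPhysics.StatisticalMechanics.lennardJones) =
      P.energyPerParticle Literature.MathematicalPhysics.StatisticalMechanics.lennardJones := hleast.csInf_eq
  have hlim : Filter.Tendsto (fun N : ℕ => Literature.MathematicalPhysics.StatisticalMechanics.groundStateEnergy
      Literature.MathematicalPhysics.StatisticalMechanics.lennardJones 3 N / N) Filter.atTop
      (nhds (P.energyPerParticle Literature.MathematicalPhysics.StatisticalMechanics.lennardJones)) := by
    have h0 : CrysEnergyLimit := CrysEnergyLimit_holds
    unfold CrysEnergyLimit at h0
    rw [hinf] at h0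
    exact h0
  exact ⟨⟨P, hleast, hlim⟩, hpos⟩

end Summit.AtomisticToContinuum.Crystallization.Theses.PhononSlackCertificates
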